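import Summits.HubbardSuperconductivity.HubbardSuperconductivity.Theorems.GibbsMajorantLemma
import Literature.MathematicalPhysics.QuantumLattice.PairFieldMomentum
import Literature.MathematicalPhysics.QuantumLattice.HubbardWave0LiebProofs
import Literature.MathematicalPhysics.QuantumLattice.LTQOProofs

/-!
# Route `GibbsMajorant`: the support item `MajorantTransfer` (stmt-HubbardSuperconductivity-15718)

If `exp(βE₀ + aθL²) · Re Tr(e^{-βH} P e^{-aW} P) ≤ 1/2` (`H = hubbardTorus 2 L 1 U`, `P` the projection
onto the sector `S = szSector N_L 0`, `E₀ = minEnergyOn H S`, `W` the Kac-window pair operator), then every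
normalised sector ground state `ψ` has `(θ/2)·L² ≤ Re⟨ψ, W ψ⟩`.

Proof.  `X := P e^{-aW} P` is PSD (`W ⪰ 0` termwise, `e^{-aW} ≻ 0`, congruence by the Hermitian `P`),
`H` is Hermitian and `Hψ = E₀ψ`, so THE LEVER (`gibbsMajorantLemma_proof`, stmt-15717) gives
`Re⟨ψ, Xψ⟩ ≤ e^{βE₀} Re Tr(e^{-βH} X)`; `Pψ = ψ` turns the left side into `Re⟨ψ, e^{-aW}ψ⟩`, hence
`e^{aθL²} Re⟨ψ, e^{-aW}ψ⟩ ≤ 1/2`.  The exponential Chebyshev inequality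
`t(1 − e^{at} Re⟨ψ, e^{-aW}ψ⟩) ≤ Re⟨ψ, Wψ⟩` (`W ⪰ 0`, `‖ψ‖ = 1`; pointwise `w ≥ t(1 − e^{a(t−w)})`
averaged over the spectral measure of `ψ`) with `t = θL²` finishes.  Tasaki (2020) App. A.
No definition is introduced.
-/

set_option linter.dupNamespace false

noncomputable section

open scoped Matrix.Norms.L2Operator ComplexOrder MatrixOrder ComplexConjugate
open Matrix Finset Literature.MathematicalPhysics.QuantumLattice Literature.Probability.LatticeModels

namespace Summit.HubbardSuperconductivity.HubbardSuperconductivity.Theorems.GibbsMajorant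

/-! ### Exponential Chebyshev for a positive semidefinite matrix -/

section Spectral

variable {n : Type*} [Fintype n] [DecidableEq n] {A : Matrix n n ℂ}

/-- `Re⟨v, e^{-aA} v⟩ = Σ_i e^{-aλ_i} |(Uᴴv)_i|²` in the eigenbasis of the Hermitian `A`. [folklore] -/
theorem re_star_dotProduct_gibbsWeight_mulVec (hA : A.IsHermitian) (a : ℝ) (v : n → ℂ) :
    (star v ⬝ᵥ gibbsWeight a A *ᵥ v).re =
      ∑ i, Real.exp (-a * hA.eigenvalues i) *
        ‖((hA.eigenvectorUnitary : Matrix n n ℂ)ᴴ *ᵥ v) i‖ ^ 2 := by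
  rw [gibbsWeight_eq_conj_diagonal' hA a, star_dotProduct_conj_diagonal_mulVec, Complex.re_sum]
  refine Finset.sum_congr rfl fun i _ => ?_
  rw [← Complex.ofReal_mul, Complex.ofReal_re]

/-- `Re⟨v, A v⟩ = Σ_i λ_i |(Uᴴv)_i|²` in the eigenbasis of the Hermitian `A`. [folklore] -/
theorem re_star_dotProduct_mulVec_eq_sum (hA : A.IsHermitian) (v : n → ℂ) :
    (star v ⬝ᵥ A *ᵥ v).re =
      ∑ i, hA.eigenvalues i * ‖((hA.eigenvectorUnitary : Matrix n n ℂ)ᴴ *ᵥ v) i‖ ^ 2 := by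
  conv_lhs => rw [eq_conj_diagonal_eigenvalues hA]
  rw [star_dotProduct_conj_diagonal_mulVec, Complex.re_sum]
  refine Finset.sum_congr rfl fun i _ => ?_
  rw [← Complex.ofReal_mul, Complex.ofReal_re]

/-- `‖v‖ = 1 ⇒ Σ_i |(Uᴴv)_i|² = 1`. [folklore] -/
theorem sum_norm_sq_eigenCoord_eq_one (hA : A.IsHermitian) {v : n → ℂ} (hv : star v ⬝ᵥ v = 1) :
    ∑ i, ‖((hA.eigenvectorUnitary : Matrix n n ℂ)ᴴ *ᵥ v) i‖ ^ 2 = 1 := by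
  have h := star_dotProduct_self_eq_sum _ (eigenvectorUnitary_mul_conjTranspose_self hA) v
  rw [hv] at h
  exact_mod_cast h.symm

/-- The scalar inequality behind the exponential Chebyshev bound: for `a ≥ 0`, `t > 0`, `w ≥ 0`,
`t(1 − e^{a(t − w)}) ≤ w`. [folklore] -/
theorem mul_one_sub_exp_le {a t w : ℝ} (ha : 0 ≤ a) (ht : 0 < t) (hw : 0 ≤ w) :
    t * (1 - Real.exp (a * (t - w))) ≤ w := by
  rcases le_or_gt t w with h | h
  · have : 0 ≤ Real.exp (a * (t - w)) := (Real.exp_pos _).le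
    nlinarith
  · have h1 : 1 ≤ Real.exp (a * (t - w)) := Real.one_le_exp (mul_nonneg ha (by linarith))
    nlinarith

/-- **Exponential Chebyshev for a PSD matrix.** For PSD `A`, a unit vector `v`, `a ≥ 0` and
`t > 0`: `t · (1 − e^{at} Re⟨v, e^{-aA} v⟩) ≤ Re⟨v, A v⟩`. [folklore] -/
theorem mul_one_sub_exp_mul_le_re_quadForm (hA : A.PosSemidef) {v : n → ℂ} (hv : star v ⬝ᵥ v = 1)
    {a t : ℝ} (ha : 0 ≤ a) (ht : 0 < t) :
    t * (1 - Real.exp (a * t) * (star v ⬝ᵥ gibbsWeight a A *ᵥ v).re) ≤ (star v ⬝ᵥ A *ᵥ v).re := by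
  rw [re_star_dotProduct_gibbsWeight_mulVec hA.1 a v, re_star_dotProduct_mulVec_eq_sum hA.1 v]
  set c : n → ℂ := ((hA.1.eigenvectorUnitary : Matrix n n ℂ)ᴴ *ᵥ v) with hc
  have h1 := sum_norm_sq_eigenCoord_eq_one hA.1 hv
  rw [← hc] at h1
  have hpt : ∀ i, t * (‖c i‖ ^ 2 - Real.exp (a * t) * (Real.exp (-a * hA.1.eigenvalues i) * ‖c i‖ ^ 2))
      ≤ hA.1.eigenvalues i * ‖c i‖ ^ 2 := by
    intro i
    have hsc := mul_one_sub_exp_le ha ht (hA.eigenvalues_nonneg i)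
    have hr : 0 ≤ ‖c i‖ ^ 2 := sq_nonneg _
    have hexp : Real.exp (a * t) * Real.exp (-a * hA.1.eigenvalues i) =
        Real.exp (a * (t - hA.1.eigenvalues i)) := by
      rw [← Real.exp_add]; ring_nf
    calc t * (‖c i‖ ^ 2 - Real.exp (a * t) * (Real.exp (-a * hA.1.eigenvalues i) * ‖c i‖ ^ 2))
        = (t * (1 - Real.exp (a * (t - hA.1.eigenvalues i)))) * ‖c i‖ ^ 2 := by
          rw [← hexp]; ring
      _ ≤ hA.1.eigenvalues i * ‖c i‖ ^ 2 := mul_le_mul_of_nonneg_right hsc hr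
  calc t * (1 - Real.exp (a * t) * ∑ i, Real.exp (-a * hA.1.eigenvalues i) * ‖c i‖ ^ 2)
      = ∑ i, t * (‖c i‖ ^ 2 -
          Real.exp (a * t) * (Real.exp (-a * hA.1.eigenvalues i) * ‖c i‖ ^ 2)) := by
        rw [← h1, Finset.mul_sum, ← Finset.sum_sub_distrib, Finset.mul_sum]
    _ ≤ ∑ i, hA.1.eigenvalues i * ‖c i‖ ^ 2 := Finset.sum_le_sum fun i _ => hpt i

end Spectral

/-! ### The Kac-window pair operator is positive semidefinite -/

/-- The Kac-window pair operator `W = Σ_{|q_m| ≤ ε} L⁻² Δ_d(m)ᴴΔ_d(m)` is positive semidefinite. [folklore] -/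
theorem window_posSemidef (L : ℕ) [NeZero L] (ε : ℝ) :
    (∑ m : TorusSite 2 L, if momentumNormSq L m ≤ ε ^ 2 then
        ((L : ℂ) ^ 2)⁻¹ • ((pairFieldAt dWaveFormFactor L m)ᴴ * pairFieldAt dWaveFormFactor L m)
        else 0).PosSemidef := by
  refine posSemidef_sum _ fun m _ => ?_
  split_ifs
  · refine (posSemidef_conjTranspose_mul_self _).smul ?_
    rw [show ((L : ℂ) ^ 2)⁻¹ = ((((L : ℝ) ^ 2)⁻¹ : ℝ) : ℂ) by push_cast; rfl]
    exact Complex.zero_le_real.mpr (by positivity)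
  · exact PosSemidef.zero

/-! ### The transfer -/

/-- **`MajorantTransfer` holds** (route `GibbsMajorant`, item `stmt-HubbardSuperconductivity-15718`):
the tilted Gibbs-trace bound `exp(βE₀ + aθL²)·Re Tr(e^{-βH} P e^{-aW} P) ≤ 1/2` forces
`(θ/2)L² ≤ Re⟨ψ, Wψ⟩` for every normalised sector ground state `ψ` — THE LEVER
(`gibbsMajorantLemma_proof`) at `X = P e^{-aW} P`, `Pψ = ψ`, and the exponential Chebyshev
inequality for `W ⪰ 0`. Tasaki (2020) App. A. [folklore] -/
theorem majorantTransfer_proof :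
    Summit.HubbardSuperconductivity.HubbardSuperconductivity.Theses.GibbsMajorant.MajorantTransfer := by
  intro U δ θ ε β a L _ hθ ha D W H S P hbound ψ hψ1 hGS
  obtain ⟨hmem, -, heig⟩ := hGS
  have hL2 : (0 : ℝ) < (L : ℝ) ^ 2 := by
    have : (0 : ℝ) < L := by exact_mod_cast Nat.pos_of_ne_zero (NeZero.ne L)
    positivity
  -- the players
  have hH : H.IsHermitian := LiebThm1.hamiltonian_isHermitian _ 1 U
  have hWpsd : W.PosSemidef := window_posSemidef L ε
  have hPh : P.IsHermitian := projMatrix_isHermitian _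
  have hG : (gibbsWeight a W).PosSemidef := (posDef_gibbsWeight a hWpsd.1).posSemidef
  have hX : (P * gibbsWeight a W * P).PosSemidef := by
    have h := hG.conjTranspose_mul_mul_same P
    rwa [hPh.eq] at h
  have hPψ : P *ᵥ ψ = ψ := projMatrix_map_mulVec_of_mem _ hmem
  -- THE LEVER
  have hlever := gibbsMajorantLemma_proof _ H (P * gibbsWeight a W * P) hH hX ψ _ β hψ1 heig
  -- `⟨ψ, P G P ψ⟩ = ⟨ψ, G ψ⟩`
  have hPGP : star ψ ⬝ᵥ (P * gibbsWeight a W * P) *ᵥ ψ = star ψ ⬝ᵥ gibbsWeight a W *ᵥ ψ := by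
    rw [← mulVec_mulVec, ← mulVec_mulVec, hPψ, star_dotProduct_mulVec_eq, hPh.eq, hPψ]
  rw [hPGP] at hlever
  -- `e^{aθL²} Re⟨ψ, e^{-aW}ψ⟩ ≤ 1/2`
  have hhalf : Real.exp (a * (θ * (L : ℝ) ^ 2)) * (star ψ ⬝ᵥ gibbsWeight a W *ᵥ ψ).re ≤ 1 / 2 := by
    have h1 := mul_le_mul_of_nonneg_left hlever (Real.exp_pos (a * θ * (L : ℝ) ^ 2)).le
    rw [← mul_assoc, ← Real.exp_add, add_comm] at h1
    rw [show a * (θ * (L : ℝ) ^ 2) = a * θ * (L : ℝ) ^ 2 by ring]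
    exact h1.trans hbound
  -- exponential Chebyshev with `t = θL²`
  have hcheb := mul_one_sub_exp_mul_le_re_quadForm hWpsd hψ1 ha (mul_pos hθ hL2)
  have hkey : θ * (L : ℝ) ^ 2 * (1 - 1 / 2) ≤ (star ψ ⬝ᵥ W *ᵥ ψ).re := by
    refine le_trans ?_ hcheb
    exact mul_le_mul_of_nonneg_left (by linarith) (mul_pos hθ hL2).le
  linarith

end Summit.HubbardSuperconductivity.HubbardSuperconductivity.Theorems.GibbsMajorant
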